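import Summits.RiemannHypothesis.RiemannHypothesis.Theorems.Splittings.RobinFiniteOneFactCore
import Summits.RiemannHypothesis.RiemannHypothesis.Theorems.Splittings.RobinFiniteC1All
import HarnessLib

/-!
# RobinFiniteOneFactRows — the all-integer bridge from Büthe 2018 alone and the Platt–Trudgian Robin row with three print theorems

Cell rh-split, seat rh-split-robin-finite g17 (brief sha16 f79c5f09d8bcb036), card `cards/SPLIT-robin-finite.md` §24; carved verbatim from the
kernel-checked object `HOME/rh-split-robin-finite/g17/SketchG17-OneFact.lean` (rc 0, 0 warnings, 0 sorries, standard axioms).  Zero `def`,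
zero `instance`, zero `notation`, no attribute changes, no `native_decide`.

GEN 17 «ONE PRINT FACT», part 3/3: the all-integer bridge from Büthe 2018 alone (`theta_ge_99947_ofB`, `robin_all_of_robinCA_below_lowB`,
`X − 1 ≤ 10¹⁹`) and the full Platt–Trudgian Robin row re-derived with THREE print theorems — `mertensProdLt_PT2_B`, `robinCA_below_PT2_B`
(`robinCA_below (2.5·10²² + 1)`), `robinCA_below_PT1_B`, `robin_le_PT2_B` (`5040 < n ≤ 10^(10²²)`) — the tree's `RobinFiniteC1Main` /
`RobinFiniteC1All` proofs verbatim over `negLog_le_Eb1_PT_B` (BKLNW 2021 dropped; it only ever served stub S4).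

HONEST LABEL: «SPLITTING SEARCH over kernel-typed RH-EQUIVALENCES; a splitting A ∧ B ⟹ RH is CONDITIONAL bookkeeping unless A and B
are both proved; nothing here bears on the truth of RH.»
-/

set_option linter.dupNamespace false

noncomputable section

open scoped Real Chebyshev ComplexConjugate

namespace Summit.RiemannHypothesis.RiemannHypothesis.Theorems.Splittings.RobinFiniteC1

open Literature.NumberTheory.LFunctions Literature.NumberTheory.DiophantineGeometry
open NicolasJ NicolasFz NicolasK NicolasJExplicit
open Summit.RiemannHypothesis.RiemannHypothesis.Theorems.Splittings.RobinFiniteE1c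
open Summit.RiemannHypothesis.RiemannHypothesis.Theorems.Splittings.RobinFiniteE3

section OneFact

open Complex Filter Set MeasureTheory Topology intervalIntegral

/-! ### O6 · the all-integer bridge from Büthe 2018 alone (`X − 1 ≤ 10¹⁹`) -/

/-- **`θ(x) ≥ 0.99947·x` for `2²⁴ ≤ x ≤ 10¹⁹` from Büthe 2018 alone** (`x − θ(x) ≤ 1.95√x ≤ 0.00053·x`; the tree's `theta_ge_99947_of_facts`
needs BKLNW only beyond `10¹⁹`). -/
theorem theta_ge_99947_ofB (hB : Buthe2018_thm2_theta) {x : ℝ} (hx : (2 : ℝ) ^ 24 ≤ x) (h19 : x ≤ (10 : ℝ) ^ 19) :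
    0.99947 * x ≤ θ x := by
  have hx0 : 0 < x := lt_of_lt_of_le (by norm_num) hx
  have h1 := hB.1 x (le_trans (by norm_num) hx) h19
  have hsx : √x * √x = x := Real.mul_self_sqrt hx0.le
  have hs0 : (4096 : ℝ) ≤ √x := by
    have : √((2 : ℝ) ^ 24) = 4096 := by
      rw [show ((2 : ℝ) ^ 24) = 4096 ^ 2 by norm_num, Real.sqrt_sq (by norm_num)]
    rw [← this]; exact Real.sqrt_le_sqrt hx
  nlinarith [Real.sqrt_nonneg x]

/-- **The parameter bridge at range `X ≤ 10¹⁹ + 1` from Büthe 2018 alone** (`RobinFiniteLowHeightRanges.robin_all_of_robinCA_below_low` minus `hK`):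
`robinCA_below (X + 1)` for `2²⁴ + 1 ≤ X`, `X − 1 ≤ 10¹⁹` gives Robin's inequality for every `5040 < n` with `log n ≤ 0.99947·(X − 1)`. -/
theorem robin_all_of_robinCA_below_lowB (hB : Buthe2018_thm2_theta) {X : ℕ} (hRB : robinCA_below (X + 1))
    (hX : 2 ^ 24 + 1 ≤ X) (hX19 : (X : ℝ) - 1 ≤ (10 : ℝ) ^ 19) :
    ∀ n : ℕ, 5040 < n → Real.log n ≤ 0.99947 * ((X : ℝ) - 1) → robinInequality n := by
  classical
  have hX1 : 1 ≤ X := le_trans (by norm_num) hX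
  have hXR : ((2 : ℝ) ^ 24 + 1) ≤ (X : ℝ) := by exact_mod_cast hX
  have h24 : (2 : ℝ) ^ 24 ≤ (X : ℝ) - 1 := by linarith
  have hW1 : 0.99947 * ((X : ℝ) - 1) ≤ θ ((X : ℝ) - 1) := theta_ge_99947_ofB hB h24 hX19
  set ε : ℝ := Real.log (1 + 1 / (X : ℝ)) / Real.log (X : ℝ) with hε_def
  have hBs1 : (1 : ℝ) < (X : ℝ) := by linarith
  have hε : 0 < ε := by
    refine div_pos (Real.log_pos ?_) (Real.log_pos hBs1)
    have : (0 : ℝ) < 1 / (X : ℝ) := by positivity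
    linarith
  obtain ⟨Ns, hNs1, hNs, -⟩ := Nat.exists_greatest_isCAParameter hε
  have hNs0 : Ns ≠ 0 := by omega
  have hthr : ∀ r : ℕ, r.Prime → (r : ℝ) ^ ε ≤ 1 + 1 / r → r < X + 1 := by
    intro r hr hle
    by_contra hge
    push Not at hge
    have hr' : (X : ℝ) < r := by
      have : ((X + 1 : ℕ) : ℝ) ≤ r := by exact_mod_cast hge
      push_cast at this; linarith
    have := one_add_inv_lt_rpow hBs1 hr'
    rw [← hε_def] at this
    linarith
  have hdiv : ∀ p ∈ Nat.primesLE (X - 1), p ∣ Ns := by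
    intro p hp
    obtain ⟨hple, hpp⟩ := Nat.mem_primesLE.1 hp
    refine dvd_of_rpow_lt hNs hNs0 hpp (rpow_lt_one_add_inv hBs1 (by exact_mod_cast hpp.one_lt) ?_)
    have h1 : p < X := by omega
    exact_mod_cast h1
  have hprod : (∏ p ∈ Nat.primesLE (X - 1), p) ∣ Ns :=
    Finset.prod_primes_dvd Ns (fun p hp => (Nat.mem_primesLE.1 hp).2.prime) hdiv
  have hlogNs : 0.99947 * ((X : ℝ) - 1) ≤ Real.log Ns := by
    have hle : (∏ p ∈ Nat.primesLE (X - 1), p) ≤ Ns := Nat.le_of_dvd (by omega) hprod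
    have hpos : ∀ p ∈ Nat.primesLE (X - 1), ((p : ℕ) : ℝ) ≠ 0 := fun p hp => by
      exact_mod_cast (Nat.mem_primesLE.1 hp).2.ne_zero
    have h1 : Real.log ((∏ p ∈ Nat.primesLE (X - 1), p : ℕ) : ℝ) = θ (((X - 1 : ℕ)) : ℝ) := by
      rw [Chebyshev.theta_eq_sum_primesLE_log, Nat.cast_prod, Real.log_prod hpos]
    have hprodpos : (0 : ℝ) < ((∏ p ∈ Nat.primesLE (X - 1), p : ℕ) : ℝ) := by
      rw [Nat.cast_prod]; exact Finset.prod_pos fun p hp => by exact_mod_cast (Nat.mem_primesLE.1 hp).2.pos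
    have h2 : Real.log ((∏ p ∈ Nat.primesLE (X - 1), p : ℕ) : ℝ) ≤ Real.log Ns :=
      Real.log_le_log hprodpos (by exact_mod_cast hle)
    have hcast : (((X - 1 : ℕ)) : ℝ) = (X : ℝ) - 1 := Nat.cast_pred (by omega)
    rw [h1, hcast] at h2
    exact hW1.trans h2
  have hNs5040 : 5040 < Ns := by
    by_contra hle
    push Not at hle
    have h1 : (Ns : ℝ) ≤ 5040 := by exact_mod_cast hle
    have h2 : Real.log Ns ≤ Real.log 5040 := Real.log_le_log (by exact_mod_cast hNs1) h1
    have h3 : Real.log 5040 ≤ 5040 - 1 := Real.log_le_sub_one_of_pos (by norm_num)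
    have h4 : (2 : ℝ) ^ 24 = 16777216 := by norm_num
    rw [h4] at h24
    linarith
  intro n hn hlog
  refine robin_all_of_robinCA_below hRB hε hthr hNs hNs5040 n hn ?_
  by_contra hgt
  push Not at hgt
  have h3 : Real.log Ns < Real.log n :=
    Real.log_lt_log (by exact_mod_cast hNs1) (by exact_mod_cast hgt)
  linarith

end OneFact

section OneFactPT

open Real Filter Finset
open RobinAnalyticSharp

/-! ### O5′ · the full Platt–Trudgian Robin row re-derived with THREE print theorems (tree `RobinFiniteC1Main` / `RobinFiniteC1All` verbatim, `hK` gone) -/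

/-- **The CA Mertens inequality for `4¹¹ ≤ P ≤ 2.5·10²²`, `Q ≤ P`, without BKLNW** — the tree's `RobinFiniteC1Main.mertensProdLt_PT2`
verbatim (cells below `2·10¹⁰`; `G_largeW` with the windows V1, V2, V3b; `G_large2W` with Z1–Z5), its one analytic input
`negLog_le_Eb1_PT` replaced by the BKLNW-free `negLog_le_Eb1_PT_B` (gen 17).  Print list: {Büthe 2016 Thm 2, Büthe 2018 Thm 2,
RH(3 000 175 332 800)}. -/
theorem mertensProdLt_PT2_B (h16 : Buthe2016_thm2) (hB : Buthe2018_thm2_theta)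
    (hRH : RiemannHypothesisUpTo 3000175332800) {P Q : ℕ}
    (hP : 4 ^ 11 ≤ P) (hPX : (P : ℝ) ≤ 25 * (10 : ℝ) ^ 21) (hQP : Q ≤ P) :
    (∏ p ∈ Nat.primesLE P, (1 - (p : ℝ)⁻¹))⁻¹ *
        ∏ p ∈ (Nat.primesLE P).filter (fun p => Q < p), (1 - ((p : ℝ) ^ 2)⁻¹) <
      rexp eulerMascheroniConstant * Real.log (θ P + θ Q) := by
  have hW : (∀ y : ℝ, 599 ≤ y → y ≤ 2.169e25 → |θ y - y| ≤ √y * Real.log y ^ 2 / (8 * π)) :=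
    thetaWindow_PT h16 hRH
  have hPB : (P : ℝ) ≤ 2.169e25 := hPX.trans (by norm_num)
  have hPr : (4 : ℝ) ^ 11 ≤ P := by exact_mod_cast hP
  have hP599 : (599 : ℝ) ≤ P := le_trans (by norm_num) hPr
  have hP1 : (1 : ℝ) < P := by linarith
  have hlow : ∀ X₀ X₁ : ℝ, 1 < X₀ → X₁ ≤ 2.169e25 → X₀ ≤ (P : ℝ) → (P : ℝ) ≤ X₁ →
      -Real.log (nicolasF P) ≤ (nicolasERH P + ((0.0463 + (1 + 2 / Real.log X₀) * (2.961e-12 * √X₁)) - nicolasBeta) * (1 / (√P * Real.log P) + 1 / (√P * Real.log P ^ 2) + 4 / (√P * Real.log P ^ 3))) :=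
    fun X₀ X₁ hX₀ hX₁ h0 h1 => negLog_le_Eb1_PT_B h16 hB hRH hX₀ hX₁ hP599 h0 h1
  by_cases hbig : (2 * 10 ^ 10 : ℝ) ≤ P
  · have hsL : 0 < √(P : ℝ) * Real.log P :=
      mul_pos (Real.sqrt_pos.2 (by linarith)) (Real.log_pos hP1)
    rcases le_or_gt (P : ℝ) (2 * (10 : ℝ) ^ 19) with h19 | h19
    · -- the old large branch `2·10¹⁰ ≤ P ≤ 2·10¹⁹`: constant `2.1538`
      have hG := G_largeW hW hbig hPB hQP
      suffices hwin : ∃ X₀ X₁ : ℝ, 1 < X₀ ∧ X₁ ≤ 2.169e25 ∧ X₀ ≤ (P : ℝ) ∧ (P : ℝ) ≤ X₁ ∧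
          (nicolasERH P + ((0.0463 + (1 + 2 / Real.log X₀) * (2.961e-12 * √X₁)) - nicolasBeta) * (1 / (√P * Real.log P) + 1 / (√P * Real.log P ^ 2) + 4 / (√P * Real.log P ^ 3))) * (√(P : ℝ) * Real.log P) < 2.1538 by
        obtain ⟨X₀, X₁, hX₀, hX₁, h0, h1, hlt⟩ := hwin
        refine mertens_prod_lt_of hW hP hPB (hlow X₀ X₁ hX₀ hX₁ h0 h1) ?_
        have : (nicolasERH P + ((0.0463 + (1 + 2 / Real.log X₀) * (2.961e-12 * √X₁)) - nicolasBeta) * (1 / (√P * Real.log P) + 1 / (√P * Real.log P ^ 2) + 4 / (√P * Real.log P ^ 3))) < 2.1538 / (√(P : ℝ) * Real.log P) := by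
          rw [lt_div_iff₀ hsL]; exact hlt
        exact this.trans_le hG
      rcases le_or_gt (P : ℝ) ((10 : ℝ) ^ 16) with h1 | h1
      · exact ⟨_, _, by norm_num, by norm_num, hbig, h1, Eb1_lt_V1 hbig h1⟩
      rcases le_or_gt (P : ℝ) ((10 : ℝ) ^ 19) with h2 | h2
      · exact ⟨_, _, by norm_num, by norm_num, h1.le, h2, Eb1_lt_V2 h1.le h2⟩
      · exact ⟨_, _, by norm_num, by norm_num, h2.le, h19, Eb1_lt_V3b h2.le h19⟩
    · -- the lifted large branch `2·10¹⁹ < P ≤ 2.5·10²²`: constant `c(L₁)` per window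
      have hbig19 : (2 * 10 ^ 19 : ℝ) ≤ P := h19.le
      suffices hwin : ∃ X₀ X₁ L₁ c : ℝ, 1 < X₀ ∧ X₁ ≤ 2.169e25 ∧ X₀ ≤ (P : ℝ) ∧ (P : ℝ) ≤ X₁ ∧
          L₁ ≤ Real.log X₀ ∧ 0 < L₁ ∧ c ≤ 2.9 ∧
          c ^ 2 ≤ 4 * 0.99925 * (1.8018 * L₁ / (L₁ + 9.6567) + 0.18488 * L₁ / (L₁ + 15.6481)) ∧
          (nicolasERH P + ((0.0463 + (1 + 2 / Real.log X₀) * (2.961e-12 * √X₁)) - nicolasBeta) * (1 / (√P * Real.log P) + 1 / (√P * Real.log P ^ 2) + 4 / (√P * Real.log P ^ 3))) * (√(P : ℝ) * Real.log P) < c by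
        obtain ⟨X₀, X₁, L₁, c, hX₀, hX₁, h0, h1, hL₁, hL₁0, hcA, hcC, hlt⟩ := hwin
        have hL₁P : L₁ ≤ Real.log P := hL₁.trans (Real.log_le_log (by linarith) h0)
        have hG := G_large2W hW hbig19 hPB hQP hL₁P hL₁0 hcA hcC
        refine mertens_prod_lt_of hW hP hPB (hlow X₀ X₁ hX₀ hX₁ h0 h1) ?_
        have : (nicolasERH P + ((0.0463 + (1 + 2 / Real.log X₀) * (2.961e-12 * √X₁)) - nicolasBeta) * (1 / (√P * Real.log P) + 1 / (√P * Real.log P ^ 2) + 4 / (√P * Real.log P ^ 3))) < c / (√(P : ℝ) * Real.log P) := by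
          rw [lt_div_iff₀ hsL]; exact hlt
        exact this.trans_le hG
      have hl19 : (44.442 : ℝ) ≤ Real.log (2 * (10 : ℝ) ^ 19) := log_2e19_gt.le
      have hl20 : (46.051 : ℝ) ≤ Real.log ((10 : ℝ) ^ 20) := by
        have := (log_ten_pow_bounds 20).1; push_cast at this; linarith
      have hl21 : (48.354 : ℝ) ≤ Real.log ((10 : ℝ) ^ 21) := by
        have := (log_ten_pow_bounds 21).1; push_cast at this; linarith
      have hl22 : (50.656 : ℝ) ≤ Real.log ((10 : ℝ) ^ 22) := by
        have := (log_ten_pow_bounds 22).1; push_cast at this; linarith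
      have hl2e22 : (51.35 : ℝ) ≤ Real.log (2 * (10 : ℝ) ^ 22) := by
        have e0 := log_mul_ten_pow (a := 2) (by norm_num) 22
        have h2l := Real.log_two_gt_d9
        have h10' := RobinAnalytic.log_ten_gt
        rw [e0]; push_cast; linarith
      rcases le_or_gt (P : ℝ) ((10 : ℝ) ^ 20) with h1 | h1
      · exact ⟨_, _, 44.442, 2.5422, by norm_num, by norm_num, hbig19, h1, hl19, by norm_num,
          by norm_num, by norm_num, Eb1_lt_Z1 hbig19 h1⟩
      rcases le_or_gt (P : ℝ) ((10 : ℝ) ^ 21) with h2 | h2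
      · exact ⟨_, _, 46.051, 2.5504, by norm_num, by norm_num, h1.le, h2, hl20, by norm_num,
          by norm_num, by norm_num, Eb1_lt_Z2 h1.le h2⟩
      rcases le_or_gt (P : ℝ) ((10 : ℝ) ^ 22) with h3 | h3
      · exact ⟨_, _, 48.354, 2.5614, by norm_num, by norm_num, h2.le, h3, hl21, by norm_num,
          by norm_num, by norm_num, Eb1_lt_Z3 h2.le h3⟩
      rcases le_or_gt (P : ℝ) (2 * (10 : ℝ) ^ 22) with h4 | h4
      · exact ⟨_, _, 50.656, 2.5716, by norm_num, by norm_num, h3.le, h4, hl22, by norm_num,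
          by norm_num, by norm_num, Eb1_lt_Z4 h3.le h4⟩
      · exact ⟨_, _, 51.35, 2.5745, by norm_num, by norm_num, h4.le, hPX, hl2e22, by norm_num,
          by norm_num, by norm_num, Eb1_lt_Z5 h4.le hPX⟩
  · -- the cells `4¹¹ ≤ P < 2·10¹⁰ < 4¹⁸`, budget `budgetPT1 4¹¹ (2·10¹⁰) ≤ 0.04631`
    rw [not_le] at hbig
    have hP18 : P < 4 ^ 18 := by
      have : (P : ℝ) < 4 ^ 18 := hbig.trans (by norm_num)
      exact_mod_cast this
    have h1 := hlow ((4 : ℝ) ^ 11) (2 * 10 ^ 10) (by norm_num) (by norm_num) hPr hbig.le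
    have h1' := h1.trans (Eb_mono hP1 budgetPT1_cells_le)
    refine mertens_prod_lt_of hW hP hPB h1' ?_
    have hb : nicolasBeta ≤ 0.04631 := by linarith [FordL33.nicolasBeta_lt_d5]
    have hb' : (0.04631 : ℝ) * 1.1875 ≤ ((Cells.bU : ℚ) : ℝ) := by
      simp only [Cells.bU]; push_cast; norm_num
    exact key_ineq_cellsW hW (eboxOn_Eb hb hb') hP hP18 hPB hQP


open scoped ArithmeticFunction.sigma in
/-- **HEADLINE O5 (gen 17): Robin's inequality at every colossally abundant `N > 5040` all of whose primes are `≤ 2.5·10²²`**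
(`robinCA_below (2.5·10²² + 1)`), modulo THREE theorems in print in hypothesis position — {Büthe 2016 Thm 2, Büthe 2018 Thm 2,
RH(3 000 175 332 800) (Platt–Trudgian 2021)} — where the tree's `robinCA_below_PT2` lists four (BKLNW 2021 §1.2 dropped: it only ever
served stub S4, now `jk_partial_le_ofB`).  Same bookkeeping, verbatim.  Nothing here bears on the truth of RH. -/
theorem robinCA_below_PT2_B (h16 : Buthe2016_thm2) (hB : Buthe2018_thm2_theta)
    (hRH : RiemannHypothesisUpTo 3000175332800) :
    robinCA_below (25 * 10 ^ 21 + 1) := by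
  intro N hCA h5040 hprimes
  obtain ⟨ε, P, Q, -, -, hP, hPN, -, hQP, hpf, -, -, hσ, hθ, -⟩ := hCA.exists_structure
  by_cases hsmall : P < 4 ^ 11
  · refine robinCA_below_four_pow_eleven N hCA h5040 fun p hp hpN => lt_of_le_of_lt ?_ hsmall
    have hN0 : N ≠ 0 := by omega
    have : p ∈ N.primeFactors := Nat.mem_primeFactors.2 ⟨hp, hpN, hN0⟩
    rw [hpf] at this
    exact (Nat.mem_primesLE.1 this).1
  · rw [not_lt] at hsmall
    have hPX : (P : ℝ) ≤ 25 * (10 : ℝ) ^ 21 := by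
      have := hprimes P hP hPN
      exact_mod_cast Nat.lt_succ_iff.1 this
    have hlt := mertensProdLt_PT2_B h16 hB hRH hsmall hPX hQP
    have hN0 : N ≠ 0 := by omega
    have hNpos : (0 : ℝ) < N := by exact_mod_cast Nat.pos_of_ne_zero hN0
    have hθpos : 0 < θ P + θ Q := by
      have h1 : 0 < θ (P : ℝ) := Chebyshev.theta_pos (by exact_mod_cast hP.two_le)
      have h2 : 0 ≤ θ (Q : ℝ) := Chebyshev.theta_nonneg _
      linarith
    have hlog : Real.log (θ P + θ Q) ≤ Real.log (Real.log N) := Real.log_le_log hθpos hθ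
    have hlt' : (σ 1 N : ℝ) / N < rexp eulerMascheroniConstant * Real.log (Real.log N) :=
      lt_of_le_of_lt hσ (hlt.trans_le (mul_le_mul_of_nonneg_left hlog (Real.exp_pos _).le))
    unfold robinInequality
    rw [div_lt_iff₀ hNpos] at hlt'
    linarith


/-- Corollary without BKLNW: `robinCA_below (10²¹ + 1)` from the same three print theorems. -/
theorem robinCA_below_PT1_B (h16 : Buthe2016_thm2) (hB : Buthe2018_thm2_theta)
    (hRH : RiemannHypothesisUpTo 3000175332800) :
    robinCA_below (10 ^ 21 + 1) :=
  robinCA_below_anti (by norm_num) (robinCA_below_PT2_B h16 hB hRH)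


/-- **HEADLINE O5, all integers (gen 17): Robin's inequality `σ(n) < e^γ n log log n` for every `5040 < n ≤ 10^(10^22)`** modulo
{Büthe 2016 Thm 2, Büthe 2018 Thm 2, RH up to `3 000 175 332 800` (Platt–Trudgian 2021)} — THREE print theorems, no conjecture, no BKLNW
(the tree's `robin_le_PT2` verbatim over `robinCA_below_PT2_B`; the bridge's `θ`-input is the Platt–Trudgian window `theta_ge_99947W`, which
never needed BKLNW).  Print benchmark in the same currency: Morrill–Platt 2021 (`5041 ≤ n ≤ 10^(10^13.11485)`).  Nothing here bears on
the truth of RH. -/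
theorem robin_le_PT2_B (h16 : Buthe2016_thm2) (hB : Buthe2018_thm2_theta)
    (hRH : RiemannHypothesisUpTo 3000175332800) :
    ∀ n : ℕ, 5040 < n → n ≤ 10 ^ 10 ^ 22 → robinInequality n := by
  classical
  have hW := thetaWindow_PT h16 hRH
  have hRB := robinCA_below_PT2_B h16 hB hRH
  set Bs : ℝ := 25 * 10 ^ 21 with hBs_def
  set ε : ℝ := Real.log (1 + 1 / Bs) / Real.log Bs with hε_def
  have hBs1 : (1 : ℝ) < Bs := by rw [hBs_def]; norm_num
  have hε : 0 < ε := by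
    refine div_pos (Real.log_pos ?_) (Real.log_pos hBs1)
    have : (0 : ℝ) < 1 / Bs := by positivity
    linarith
  obtain ⟨Ns, hNs1, hNs, -⟩ := Nat.exists_greatest_isCAParameter hε
  have hNs0 : Ns ≠ 0 := by omega
  -- threshold: primes with `r^ε ≤ 1 + 1/r` are `≤ B⋆ < 25·10²¹ + 1`
  have hthr : ∀ r : ℕ, r.Prime → (r : ℝ) ^ ε ≤ 1 + 1 / r → r < 25 * 10 ^ 21 + 1 := by
    intro r hr hle
    by_contra hge
    push Not at hge
    have hr' : Bs < r := by
      rw [hBs_def]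
      have : ((25 * 10 ^ 21 + 1 : ℕ) : ℝ) ≤ r := by exact_mod_cast hge
      push_cast at this; linarith
    have := one_add_inv_lt_rpow hBs1 hr'
    rw [← hε_def] at this
    linarith
  -- every prime `p ≤ 2.4·10²²` divides `N⋆`
  have hdiv : ∀ p ∈ Nat.primesLE (24 * 10 ^ 21), p ∣ Ns := by
    intro p hp
    obtain ⟨hple, hpp⟩ := Nat.mem_primesLE.1 hp
    refine dvd_of_rpow_lt hNs hNs0 hpp (rpow_lt_one_add_inv hBs1 (by exact_mod_cast hpp.one_lt) ?_)
    have : (p : ℝ) ≤ 24 * 10 ^ 21 := by exact_mod_cast hple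
    rw [hBs_def]; linarith
  have hprod : (∏ p ∈ Nat.primesLE (24 * 10 ^ 21), p) ∣ Ns :=
    Finset.prod_primes_dvd Ns (fun p hp => (Nat.mem_primesLE.1 hp).2.prime) hdiv
  -- hence `log N⋆ ≥ θ(2.4·10²²) ≥ 0.99947 · 2.4·10²²`
  have hlogNs : (2.398728e22 : ℝ) ≤ Real.log Ns := by
    have hle : (∏ p ∈ Nat.primesLE (24 * 10 ^ 21), p) ≤ Ns := Nat.le_of_dvd (by omega) hprod
    have hpos : ∀ p ∈ Nat.primesLE (24 * 10 ^ 21), ((p : ℕ) : ℝ) ≠ 0 := fun p hp => by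
      exact_mod_cast (Nat.mem_primesLE.1 hp).2.ne_zero
    have h1 : Real.log ((∏ p ∈ Nat.primesLE (24 * 10 ^ 21), p : ℕ) : ℝ) = θ ((24 * 10 ^ 21 : ℕ) : ℝ) := by
      rw [Chebyshev.theta_eq_sum_primesLE_log, Nat.cast_prod, Real.log_prod hpos]
    have hprodpos : (0 : ℝ) < ((∏ p ∈ Nat.primesLE (24 * 10 ^ 21), p : ℕ) : ℝ) := by
      rw [Nat.cast_prod]; exact Finset.prod_pos fun p hp => by exact_mod_cast (Nat.mem_primesLE.1 hp).2.pos
    have h2 : Real.log ((∏ p ∈ Nat.primesLE (24 * 10 ^ 21), p : ℕ) : ℝ) ≤ Real.log Ns :=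
      Real.log_le_log hprodpos (by exact_mod_cast hle)
    rw [h1] at h2
    have h3 : 0.99947 * ((24 * 10 ^ 21 : ℕ) : ℝ) ≤ θ ((24 * 10 ^ 21 : ℕ) : ℝ) :=
      theta_ge_99947W hW (by norm_num) (by norm_num)
    have h4 : (0.99947 : ℝ) * ((24 * 10 ^ 21 : ℕ) : ℝ) = 2.398728e22 := by norm_num
    rw [h4] at h3
    exact h3.trans h2
  have hNs5040 : 5040 < Ns := by
    by_contra hle
    push Not at hle
    have h1 : (Ns : ℝ) ≤ 5040 := by exact_mod_cast hle
    have h2 : Real.log Ns ≤ Real.log 5040 := Real.log_le_log (by exact_mod_cast hNs1) h1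
    have h3 : Real.log 5040 ≤ 5040 - 1 := Real.log_le_sub_one_of_pos (by norm_num)
    linarith
  intro n hn hle
  -- `n ≤ 10^(10^22) ⟹ log n ≤ 10²² log 10 < 0.99947·2.4·10²² ≤ log N⋆ ⟹ n ≤ N⋆`; the power is never evaluated
  -- (`hle` is consumed by the abstract bridge and cleared before any arithmetic tactic sees it).
  have hn0 : 0 < n := lt_of_le_of_lt (Nat.zero_le 5040) hn
  have h1 : Real.log n ≤ ((10 ^ 22 : ℕ) : ℝ) * Real.log 10 := log_le_of_le_ten_pow hn0 hle
  clear hle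
  refine robin_all_of_robinCA_below hRB hε hthr hNs hNs5040 n hn ?_
  by_contra hgt
  push Not at hgt
  have h10 := RobinAnalytic.log_ten_lt
  have h3 : Real.log Ns < Real.log n :=
    Real.log_lt_log (by exact_mod_cast hNs1) (by exact_mod_cast hgt)
  have h5 : ((10 ^ 22 : ℕ) : ℝ) = 1e22 := by norm_num
  rw [h5] at h1
  have h4 : Real.log n ≤ 2.3025850935e22 := h1.trans (by nlinarith)
  exact absurd (hlogNs.trans (h3.le.trans h4)) (by norm_num)


end OneFactPT

/-- info: 'Summit.RiemannHypothesis.RiemannHypothesis.Theorems.Splittings.RobinFiniteC1.robin_all_of_robinCA_below_lowB' depends on axioms: [propext, Classical.choice, Quot.sound] -/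
#guard_msgs (whitespace := lax) in
#print axioms Summit.RiemannHypothesis.RiemannHypothesis.Theorems.Splittings.RobinFiniteC1.robin_all_of_robinCA_below_lowB

/-- info: 'Summit.RiemannHypothesis.RiemannHypothesis.Theorems.Splittings.RobinFiniteC1.robinCA_below_PT2_B' depends on axioms: [propext, Classical.choice, Quot.sound] -/
#guard_msgs (whitespace := lax) in
#print axioms Summit.RiemannHypothesis.RiemannHypothesis.Theorems.Splittings.RobinFiniteC1.robinCA_below_PT2_B

/-- info: 'Summit.RiemannHypothesis.RiemannHypothesis.Theorems.Splittings.RobinFiniteC1.robin_le_PT2_B' depends on axioms: [propext, Classical.choice, Quot.sound] -/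
#guard_msgs (whitespace := lax) in
#print axioms Summit.RiemannHypothesis.RiemannHypothesis.Theorems.Splittings.RobinFiniteC1.robin_le_PT2_B

end Summit.RiemannHypothesis.RiemannHypothesis.Theorems.Splittings.RobinFiniteC1

end
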